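import Mathlib
import HarnessLib.Audit
import Summits.PneNP.PneNP.Theorems.PstarUnionCaseBReads

/-!
# Case B, node B-II: alignment of the readers' chord parts with `w₂` (ROUND-24, memo §14.21 B-II / §14.21a; typed sketch `r24/SketchCaseB.lean`)

FRONTIER range-avoidance ladder, rung F-N3, ROUND 24 (cell `pnp-ideate`, planner memo `r24/CORE-BOUND-NOTES.md` §14.21, typed node `alignment` of planner p3 g22's
`r24/SketchCaseB.lean`, statement VERBATIM up to spelling out `Reads`; restricted-model proof complexity — nothing here bears on `P` versus `NP`).

* `exists_double_sheet` — for chords `c ≠ c'` with `w₂` reading `c` (gate-free): a point of `Z = Sol(J₀) ∩ {w₂ = t₂}` on BOTH sheets (`m_c = m_{c'} = 0`): CORE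
  `PstarUnionChordPair.chordPair_surjective (false,false)`, the `(0,0)`-reset of `c'`, and B7 `PstarUnionCaseB.exists_Z_of_sheet` on `c`;
* `align_reader` — a reader pinned on `Z` and gate-free on the chord privates has chord part `ε · (chord part of w₂)` with ONE `ε` for all chords (B8
  `PstarUnionCaseB.aligned_of_pinned` on the pairs `(c₀, c)`, B-I `PstarUnionCaseBReads.chords_read_of_one` for the reads of `w₂`);
* `alignment` — **B-II**: with at least two chords and `w₂` reading a chord literal, `Aᵢ.1 ∩ privates(c) = if εᵢ then w₂.1 ∩ privates(c) else ∅` for every chord `c`.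
-/

set_option linter.dupNamespace false -- `Summit.PneNP.PneNP.…`: summit = sub-problem name (D-0017 single-conjunct layout)

open Finset Literature.Computability.Complexity
open Summit.PneNP.PneNP.Theorems.PstarFibrePolys (bit bit_injective)
open Summit.PneNP.PneNP.Theorems.PstarTyped (Typed)
open Summit.PneNP.PneNP.Theorems.PstarSALevel (varSet bdry BoundaryExpanding SimpleOverlap)
open Summit.PneNP.PneNP.Theorems.PstarGapPeeling (not_mem_varSet_of_private eval_pure)
open Summit.PneNP.PneNP.Theorems.PstarCentreFree (vars_mem_varSet)
open Summit.PneNP.PneNP.Theorems.PstarGapOneAll (gval)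
open Summit.PneNP.PneNP.Theorems.PstarCoreBound (XorClosed)
open Summit.PneNP.PneNP.Theorems.PstarChordRepair (IsChord)
open Summit.PneNP.PneNP.Theorems.PstarChordBridgeCotree (Peelable)
open Summit.PneNP.PneNP.Theorems.PstarChordBridgeTools (privs mem_privs)
open Summit.PneNP.PneNP.Theorems.PstarUnion (SatPair UnionTerminal)
open Summit.PneNP.PneNP.Theorems.PstarUnionCaseB (setPair_two setPair_of_ne eval_setPair_of_ne exists_Z_of_sheet aligned_of_pinned)
open Summit.PneNP.PneNP.Theorems.PstarUnionChordPair (chordPair_surjective)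
open Summit.PneNP.PneNP.Theorems.PstarUnionCaseBReads (eval_reset_iff chords_read_of_one)

namespace Summit.PneNP.PneNP.Theorems.PstarUnionCaseBAlign

variable {n m : ℕ}

/-- **A point of `Z` on two sheets.**  For chords `c ≠ c'` of a maximal peelable `F` with `w₂` reading a literal of `c` (no monomial on its privates), some solution of `J₀` with
`w₂ = t₂` has both private products `0` (indeed the pair of `c'` at `(0,0)`). -/
theorem exists_double_sheet (I : LocalMap 4 n m) (hI : I.IsPure xorAndPred) (hT : Typed I) (hS : SimpleOverlap I) {r : ℕ} (hE : BoundaryExpanding r I)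
    {y : Fin m → Bool} {J₀ : Finset (Fin m)} (hX : XorClosed I J₀) (hr : J₀.card < r)
    {F : Finset (Fin m)} (hF : F ⊆ J₀) (hP : Peelable I F) (hmax : ∀ F', F ⊆ F' → F' ⊆ J₀ → Peelable I F' → F' = F)
    (hchord : ∀ e ∈ J₀ \ F, IsChord I J₀ e) (w₂ : Finset (Fin n) × Finset (Fin m) × Bool)
    {c c' : Fin m} (hc : c ∈ J₀ \ F) (hc' : c' ∈ J₀ \ F) (hne : c ≠ c')
    (hg : ∀ g ∈ w₂.2.1, I.vars g 2 ≠ I.vars c 2 ∧ I.vars g 3 ≠ I.vars c 2 ∧ I.vars g 2 ≠ I.vars c 3 ∧ I.vars g 3 ≠ I.vars c 3)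
    (hread : I.vars c 2 ∈ w₂.1 ∨ I.vars c 3 ∈ w₂.1) :
    ∃ x : Fin n → Bool, (∀ j ∈ J₀, I.eval x j = y j) ∧ gval I w₂.1 w₂.2.1 x = w₂.2.2 ∧
      (x (I.vars c 2) && x (I.vars c 3)) = false ∧ x (I.vars c' 2) = false ∧ x (I.vars c' 3) = false := by
  classical
  have hcJ : c ∈ J₀ := (mem_sdiff.1 hc).1
  have hc'J : c' ∈ J₀ := (mem_sdiff.1 hc').1
  have hchc := hchord c hc
  have hchc' := hchord c' hc'
  obtain ⟨x, hxJ, h2, h3, h2', h3', hcx, hc'x⟩ := chordPair_surjective I hI hT hS hE hX hr hF hP hmax hchord hc hc' hne false false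
  have hvc : I.eval x c ≠ y c := fun h => Bool.false_ne_true (hcx.1 h)
  have hvc' : I.eval x c' ≠ y c' := fun h => Bool.false_ne_true (hc'x.1 h)
  have cross : ∀ s : Fin 4, I.vars c' s ≠ I.vars c 2 ∧ I.vars c' s ≠ I.vars c 3 := by
    intro s
    constructor
    · intro h
      exact not_mem_varSet_of_private I hcJ hc'J hne.symm hchc.1 (vars_mem_varSet I c 2) (h ▸ vars_mem_varSet I c' s)
    · intro h
      exact not_mem_varSet_of_private I hcJ hc'J hne.symm hchc.2 (vars_mem_varSet I c 3) (h ▸ vars_mem_varSet I c' s)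
  set x' : Fin n → Bool := Function.update (Function.update x (I.vars c' 2) false) (I.vars c' 3) false with hx'
  have hx'J : ∀ j ∈ J₀, j ≠ c → I.eval x' j = y j := by
    intro j hj hjc
    by_cases hjc' : j = c'
    · subst hjc'
      exact (eval_reset_iff I hI j x h2' h3' (y j)).2 hvc'
    · rw [hx', eval_setPair_of_ne I hc'J hchc' x false false hj hjc']
      exact hxJ j hj hjc hjc'
  have hx'c2 : x' (I.vars c 2) = true := by rw [hx', setPair_of_ne I c' x false false (cross 2).1.symm (cross 3).1.symm]; exact h2
  have hx'c3 : x' (I.vars c 3) = true := by rw [hx', setPair_of_ne I c' x false false (cross 2).2.symm (cross 3).2.symm]; exact h3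
  have h0 : I.eval (Function.update (Function.update x' (I.vars c 2) false) (I.vars c 3) false) c = y c := by
    refine (eval_reset_iff I hI c x' hx'c2 hx'c3 (y c)).2 ?_
    rw [hx', eval_setPair_of_ne I hc'J hchc' x false false hcJ hne]
    exact hvc
  obtain ⟨a, b, hab, hsol, hw₂⟩ := exists_Z_of_sheet I hI hcJ hchc w₂ hg hread hx'J h0
  have h23 : I.vars c' 2 ≠ I.vars c' 3 := fun h => absurd (hI.2 c' h) (by decide)
  refine ⟨_, hsol, hw₂, ?_, ?_, ?_⟩
  · rw [(setPair_two I hI c x' a b).1, (setPair_two I hI c x' a b).2]; exact hab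
  · rw [setPair_of_ne I c x' a b (cross 2).1 (cross 2).2, hx', Function.update_of_ne h23, Function.update_self]
  · rw [setPair_of_ne I c x' a b (cross 3).1 (cross 3).2, hx', Function.update_self]

/-- **One sign per reader.**  In a union-terminal configuration with admissible `F`, hun, `w₂` reading a literal of `c₀`, and a second chord `c₁ ≠ c₀`: a constraint `φ` that is
pinned on `Z` and gate-free on every chord's privates has chord part `ε · (chord part of w₂)` for ONE `ε`, at every chord. -/
theorem align_reader (I : LocalMap 4 n m) (hI : I.IsPure xorAndPred) (hT : Typed I) (hS : SimpleOverlap I) {r : ℕ} (hE : BoundaryExpanding r I)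
    {y : Fin m → Bool} {J₀ : Finset (Fin m)} {A₀ A₁ w₂ : Finset (Fin n) × Finset (Fin m) × Bool} (hU : UnionTerminal I r y J₀ A₀ A₁ w₂)
    {F : Finset (Fin m)} (hF : F ⊆ J₀) (hP : Peelable I F) (hmax : ∀ F', F ⊆ F' → F' ⊆ J₀ → Peelable I F' → F' = F)
    (hchord : ∀ e ∈ J₀ \ F, IsChord I J₀ e) (hun : ∀ g ∈ A₀.2.1 ∪ w₂.2.1, ∀ v ∈ privs I (J₀ \ F), I.vars g 2 ≠ v ∧ I.vars g 3 ≠ v)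
    {c₀ c₁ : Fin m} (hc₀ : c₀ ∈ J₀ \ F) (hc₁ : c₁ ∈ J₀ \ F) (hne : c₀ ≠ c₁) (hread : I.vars c₀ 2 ∈ w₂.1 ∨ I.vars c₀ 3 ∈ w₂.1)
    (φ : Finset (Fin n) × Finset (Fin m) × Bool)
    (hφ : ∀ e ∈ J₀ \ F, ∀ g ∈ φ.2.1, I.vars g 2 ≠ I.vars e 2 ∧ I.vars g 3 ≠ I.vars e 2 ∧ I.vars g 2 ≠ I.vars e 3 ∧ I.vars g 3 ≠ I.vars e 3)
    (hpin : ∀ x x' : Fin n → Bool, (∀ j ∈ J₀, I.eval x j = y j) → gval I w₂.1 w₂.2.1 x = w₂.2.2 →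
      (∀ j ∈ J₀, I.eval x' j = y j) → gval I w₂.1 w₂.2.1 x' = w₂.2.2 → gval I φ.1 φ.2.1 x = gval I φ.1 φ.2.1 x') :
    ∃ ε : Bool, ∀ c ∈ J₀ \ F, φ.1 ∩ {I.vars c 2, I.vars c 3} = (if ε then w₂.1 ∩ {I.vars c 2, I.vars c 3} else ∅) := by
  classical
  have hX : XorClosed I J₀ := hU.2.1
  have hJr : J₀.card < r := hU.2.2.1
  have gf₂ : ∀ e ∈ J₀ \ F, ∀ g ∈ w₂.2.1, I.vars g 2 ≠ I.vars e 2 ∧ I.vars g 3 ≠ I.vars e 2 ∧ I.vars g 2 ≠ I.vars e 3 ∧ I.vars g 3 ≠ I.vars e 3 := by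
    intro e he g hg
    have h2 := hun g (mem_union_right _ hg) _ ((mem_privs I).2 ⟨e, he, Or.inl rfl⟩)
    have h3 := hun g (mem_union_right _ hg) _ ((mem_privs I).2 ⟨e, he, Or.inr rfl⟩)
    exact ⟨h2.1, h2.2, h3.1, h3.2⟩
  have hall := chords_read_of_one I hI hT hS hE hU hF hP hmax hchord hun hc₀ hread
  -- B8 on each pair `(c₀, c)`
  have B8 : ∀ c ∈ J₀ \ F, c ≠ c₀ →
      (φ.1 ∩ {I.vars c₀ 2, I.vars c₀ 3} = ∅ ∨ φ.1 ∩ {I.vars c₀ 2, I.vars c₀ 3} = w₂.1 ∩ {I.vars c₀ 2, I.vars c₀ 3}) ∧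
      (φ.1 ∩ {I.vars c 2, I.vars c 3} = ∅ ∨ φ.1 ∩ {I.vars c 2, I.vars c 3} = w₂.1 ∩ {I.vars c 2, I.vars c 3}) ∧
      (φ.1 ∩ {I.vars c₀ 2, I.vars c₀ 3} = ∅ ↔ φ.1 ∩ {I.vars c 2, I.vars c 3} = ∅) := by
    intro c hc hcne
    obtain ⟨x, hx, hxw, h0, h2', h3'⟩ :=
      exists_double_sheet I hI hT hS hE hX hJr hF hP hmax hchord w₂ hc₀ hc (Ne.symm hcne) (gf₂ c₀ hc₀) hread
    exact aligned_of_pinned I hI (mem_sdiff.1 hc₀).1 (mem_sdiff.1 hc).1 (hchord c₀ hc₀) (hchord c hc) (Ne.symm hcne) w₂ φ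
      ⟨gf₂ c₀ hc₀, gf₂ c hc⟩ ⟨hφ c₀ hc₀, hφ c hc⟩ ⟨hread, hall c hc⟩ hpin hx hxw h0 (by rw [h2', h3']; rfl)
  by_cases hε : φ.1 ∩ {I.vars c₀ 2, I.vars c₀ 3} = ∅
  · refine ⟨false, fun c hc => ?_⟩
    rw [if_neg Bool.false_ne_true]
    by_cases hcc : c = c₀
    · rw [hcc]; exact hε
    · exact ((B8 c hc hcc).2.2).1 hε
  · refine ⟨true, fun c hc => ?_⟩
    rw [if_pos rfl]
    by_cases hcc : c = c₀
    · rw [hcc]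
      exact ((B8 c₁ hc₁ hne.symm).1).resolve_left hε
    · exact ((B8 c hc hcc).2.1).resolve_left fun h => hε (((B8 c hc hcc).2.2).2 h)

/-- **B-II (alignment).**  Case B with at least two chords: there are `ε₀ ε₁ : Bool` with `Aᵢ.1 ∩ privates(c) = if εᵢ then w₂.1 ∩ privates(c) else ∅` for every chord `c`. -/
theorem alignment (I : LocalMap 4 n m) (hI : I.IsPure xorAndPred) (hT : Typed I) (hS : SimpleOverlap I) {r : ℕ} (hE : BoundaryExpanding r I)
    {y : Fin m → Bool} {J₀ : Finset (Fin m)} {A₀ A₁ w₂ : Finset (Fin n) × Finset (Fin m) × Bool} (hU : UnionTerminal I r y J₀ A₀ A₁ w₂)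
    {F : Finset (Fin m)} (hF : F ⊆ J₀) (hP : Peelable I F) (hmax : ∀ F', F ⊆ F' → F' ⊆ J₀ → Peelable I F' → F' = F)
    (hchord : ∀ e ∈ J₀ \ F, IsChord I J₀ e) (hun : ∀ g ∈ A₀.2.1 ∪ w₂.2.1, ∀ v ∈ privs I (J₀ \ F), I.vars g 2 ≠ v ∧ I.vars g 3 ≠ v)
    {c₀ c₁ : Fin m} (hc₀ : c₀ ∈ J₀ \ F) (hc₁ : c₁ ∈ J₀ \ F) (hne : c₀ ≠ c₁) (hread : I.vars c₀ 2 ∈ w₂.1 ∨ I.vars c₀ 3 ∈ w₂.1) :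
    ∃ ε₀ ε₁ : Bool, ∀ c ∈ J₀ \ F,
      A₀.1 ∩ {I.vars c 2, I.vars c 3} = (if ε₀ then w₂.1 ∩ {I.vars c 2, I.vars c 3} else ∅) ∧
      A₁.1 ∩ {I.vars c 2, I.vars c 3} = (if ε₁ then w₂.1 ∩ {I.vars c 2, I.vars c 3} else ∅) := by
  have hG : A₁.2.1 = A₀.2.1 := hU.2.2.2.1
  have hn₀ : ¬ SatPair I y J₀ A₀ w₂ := hU.2.2.2.2.2.2.2.2.1
  have hn₁ : ¬ SatPair I y J₀ A₁ w₂ := hU.2.2.2.2.2.2.2.2.2.1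
  have gf₀ : ∀ e ∈ J₀ \ F, ∀ g ∈ A₀.2.1, I.vars g 2 ≠ I.vars e 2 ∧ I.vars g 3 ≠ I.vars e 2 ∧ I.vars g 2 ≠ I.vars e 3 ∧ I.vars g 3 ≠ I.vars e 3 := by
    intro e he g hg
    have h2 := hun g (mem_union_left _ hg) _ ((mem_privs I).2 ⟨e, he, Or.inl rfl⟩)
    have h3 := hun g (mem_union_left _ hg) _ ((mem_privs I).2 ⟨e, he, Or.inr rfl⟩)
    exact ⟨h2.1, h2.2, h3.1, h3.2⟩
  have gf₁ : ∀ e ∈ J₀ \ F, ∀ g ∈ A₁.2.1, I.vars g 2 ≠ I.vars e 2 ∧ I.vars g 3 ≠ I.vars e 2 ∧ I.vars g 2 ≠ I.vars e 3 ∧ I.vars g 3 ≠ I.vars e 3 := by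
    rw [hG]; exact gf₀
  have pin : ∀ A : Finset (Fin n) × Finset (Fin m) × Bool, ¬ SatPair I y J₀ A w₂ →
      ∀ x x' : Fin n → Bool, (∀ j ∈ J₀, I.eval x j = y j) → gval I w₂.1 w₂.2.1 x = w₂.2.2 →
        (∀ j ∈ J₀, I.eval x' j = y j) → gval I w₂.1 w₂.2.1 x' = w₂.2.2 → gval I A.1 A.2.1 x = gval I A.1 A.2.1 x' := by
    intro A hn x x' hx hxw hx' hx'w
    have e : ∀ a b t : Bool, a ≠ t → b ≠ t → a = b := by decide
    exact e _ _ A.2.2 (fun h => hn ⟨x, hx, h, hxw⟩) (fun h => hn ⟨x', hx', h, hx'w⟩)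
  obtain ⟨ε₀, h₀⟩ := align_reader I hI hT hS hE hU hF hP hmax hchord hun hc₀ hc₁ hne hread A₀ gf₀ (pin A₀ hn₀)
  obtain ⟨ε₁, h₁⟩ := align_reader I hI hT hS hE hU hF hP hmax hchord hun hc₀ hc₁ hne hread A₁ gf₁ (pin A₁ hn₁)
  exact ⟨ε₀, ε₁, fun c hc => ⟨h₀ c hc, h₁ c hc⟩⟩

end Summit.PneNP.PneNP.Theorems.PstarUnionCaseBAlign
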